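import Summits.CriticalPhenomena.SAWScalingLimit.Theses.SAWBrickWallHomotopy
import Literature.Probability.RandomPlanarGeometry.UniformSAWCurveLaw
import Literature.Probability.LatticeModels.CellGridSaddleSymmetry
import HarnessLib

/-!
# Stub `stub_quarterTurnCovariance` of line `pin-the-shear` (crux stmt-CriticalPhenomena-14221,
# `Theses.SAWPhaseRetrieval.HexTransfer`) — item stmt-CriticalPhenomena-5794 verbatim

**Exact quarter-turn covariance of the critical `δℤ²` self-avoiding walk, at every mesh.**
`SAWBrickWallHomotopy.QuarterTurnCovariance`: (1) for every `Ω`, `δ`, `a`, `b`, the critical SAW law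
`SAW.law Ω δ a b` (weights `x_c^{|γ|}`, normalised; `SelfAvoidingWalk.lean`) pushed to curves
modulo reparametrisation and then rotated by `z ↦ i z` (`similarity I _ 0`) equals the critical SAW
law of the rotated domain `iΩ` from the rotated sites `(x, y) ↦ (-y, x)` pushed to curves; (2) an
endpoint approximation of a Dobrushin domain `D` rotates to one of `D.map (z ↦ i z)`.

Proof. The quarter turn `rotCell : (x, y) ↦ (-y, x)` of `ℤ²` together with `z ↦ i z` is a cell
symmetry of the tree (`CellSymmetry.rot`, `CellGridSaddleSymmetry.lean`), and the whole
discretisation `Ω ↦ Ω_δ` (mesh vertices, closed-segment edge rule, union of the largest components)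
is transported along it (`CellSymmetry.discreteDomainGraph_adj_cell`), so `rotCell` is a graph
isomorphism `Ω_δ ≃g (iΩ)_δ`. The general transport lemma `map_curve_law_of_iso` then does the
bookkeeping for ANY isomorphism `φ : Ω_δ ≃g Ω'_δ'` realised on mesh points by a plane map `f` affine
on segments (`f (δ x) = δ' (φ x)`): `γ ↦ φ ∘ γ` is a bijection of self-avoiding walks
(`Walk.map`, injective since `φ` is, surjective via `φ⁻¹`) preserving lengths, hence weights, so it
pushes `SAW.weight`/`SAW.law` forward to `SAW.weight`/`SAW.law` (`Measure.map_sum`,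
`Measure.sum_comp_equiv`), and the polyline of the image walk is `f ∘` the polyline of the walk with
the same dyadic parametrisation (`toCurve_map_apply`), so
`curve (φ ∘ γ) = CurveClass.map f (curve γ)` and `Measure.map_map` concludes. Clause (2):
reachability is mapped along the isomorphism, and `δ · rot (a δ) = i · (δ · a δ) → i · a`, which is
`(D.map _).pt 0`, by continuity of `z ↦ i z`.

References: V. Beffara, *Is critical 2D percolation universal?* (2008), §2.2 (the order-4 symmetry
of the square lattice); G. F. Lawler, O. Schramm, W. Werner, *On the scaling limit of planar
self-avoiding walk* (2004), §3.4.2.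
-/

noncomputable section

open MeasureTheory Filter Topology Set
open Literature.Probability.LatticeModels Literature.Probability.RandomPlanarGeometry
open Summit.CriticalPhenomena.SAWScalingLimit.Theses

namespace Summit.CriticalPhenomena.SAWScalingLimit.Cruxes.HexTransfer.PinTheShear

/-! ### Polylines and maps affine on segments -/

/-- A map affine on segments commutes with `polylineFrom`, pointwise in time (both sides carry the
same dyadic `Path.trans` parametrisation). [folklore] -/
theorem apply_polylineFrom_of_lineMap (f : ℂ → ℂ)
    (hf : ∀ (x y : ℂ) (c : ℝ), f (AffineMap.lineMap x y c) = AffineMap.lineMap (f x) (f y) c)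
    (x : ℂ) (l : List ℂ) (t : unitInterval) :
    f ((polylineFrom x l).2 t) = (polylineFrom (f x) (l.map f)).2 t := by
  induction l generalizing x t with
  | nil => rfl
  | cons y l ih =>
    change f (((Path.segment x y).trans (polylineFrom y l).2) t) =
      ((Path.segment (f x) (f y)).trans (polylineFrom (f y) (l.map f)).2) t
    rw [Path.trans_apply, Path.trans_apply]
    split_ifs with h
    · simp [Path.segment_apply, hf]
    · exact ih y _

/-- **The curve of a mapped walk is the image curve**: if the plane map `f` is affine on segments
and intertwines the two vertex embeddings along the graph homomorphism `g`
(`f (emb x) = emb' (g x)`), then the polyline of `g ∘ p` drawn with `emb'` is `f ∘` the polyline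
of `p` drawn with `emb`, with the same parametrisation. [folklore] -/
theorem toCurve_map_apply {V V' : Type*} {G : SimpleGraph V} {G' : SimpleGraph V'} (g : G →g G')
    (emb : V → ℂ) (emb' : V' → ℂ) (f : ℂ → ℂ)
    (hf : ∀ (x y : ℂ) (c : ℝ), f (AffineMap.lineMap x y c) = AffineMap.lineMap (f x) (f y) c)
    (hemb : ∀ x, f (emb x) = emb' (g x)) {u v : V} (p : G.Walk u v) (t : unitInterval) :
    (p.map g).toCurve emb' t = f (p.toCurve emb t) := by
  rw [SimpleGraph.Walk.toCurve, SimpleGraph.Walk.toCurve, SimpleGraph.Walk.support_map,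
    ← p.cons_tail_support]
  have hl : (p.support.tail.map g).map emb' = (p.support.tail.map emb).map f := by
    rw [List.map_map, List.map_map]
    exact List.map_congr_left fun x _ => (hemb x).symm
  simp only [List.map_cons, hl, ← hemb, polyline, Path.coe_toContinuousMap]
  exact (apply_polylineFrom_of_lineMap f hf _ _ t).symm

/-! ### Transport of the critical SAW law along a graph isomorphism -/

/-- A self-avoiding walk of `Ω_δ` is determined by its underlying walk. [folklore] -/
theorem domainSAW_walk_injective {Ω : Set ℂ} {δ : ℝ} {a b : Site 2} :
    Function.Injective (SAW.DomainSAW.walk : SAW.DomainSAW Ω δ a b → _) := by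
  rintro ⟨p, hp⟩ ⟨q, hq⟩ h
  dsimp only at h
  subst h
  rfl

/-- **Transport of the critical SAW law along an isomorphism of discrete domains.** If
`φ : Ω_δ ≃g Ω'_δ'` is a graph isomorphism realised on mesh points by a plane map `f` affine on
segments (`f (δ x) = δ' (φ x)`) with `CurveClass.map f` measurable, then the critical SAW law of
`Ω_δ` from `a` to `b`, pushed to curves and then along `f`, is the critical SAW law of `Ω'_δ'` from
`φ a` to `φ b` pushed to curves: `γ ↦ φ ∘ γ` is a length-preserving (hence weight-preserving)
bijection of self-avoiding walks whose curves are the `f`-images. [folklore] -/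
theorem map_curve_law_of_iso {Ω Ω' : Set ℂ} {δ δ' : ℝ}
    (φ : discreteDomainGraph Ω δ ≃g discreteDomainGraph Ω' δ') (f : C(ℂ, ℂ))
    (hfm : Measurable (CurveClass.map f))
    (hf : ∀ (x y : ℂ) (c : ℝ), f (AffineMap.lineMap x y c) = AffineMap.lineMap (f x) (f y) c)
    (hφ : ∀ x, f (meshPoint δ x) = meshPoint δ' (φ x)) {a b a' b' : Site 2} (ha : φ a = a')
    (hb : φ b = b') :
    ((SAW.law Ω δ a b).map (fun γ => γ.curve)).map (CurveClass.map f) =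
      (SAW.law Ω' δ' a' b').map (fun γ => γ.curve) := by
  subst ha hb
  have hinj : Function.Injective φ.toHom := fun x y h => φ.injective h
  -- the induced map of self-avoiding walks
  set T : SAW.DomainSAW Ω δ a b → SAW.DomainSAW Ω' δ' (φ a) (φ b) :=
    fun γ => ⟨γ.walk.map φ.toHom, γ.isPath.map hinj⟩ with hT
  have hTm : Measurable T := SAW.DomainSAW.measurable_of_top _
  have hTbij : Function.Bijective T := by
    refine ⟨fun γ₁ γ₂ h => domainSAW_walk_injective
      (SimpleGraph.Walk.map_injective_of_injective hinj a b (congrArg SAW.DomainSAW.walk h)), ?_⟩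
    rintro ⟨q, hq⟩
    refine ⟨⟨(q.map φ.symm.toHom).copy (φ.symm_apply_apply a) (φ.symm_apply_apply b), ?_⟩, ?_⟩
    · rw [SimpleGraph.Walk.isPath_copy]
      exact hq.map fun x y h => φ.symm.injective h
    · apply domainSAW_walk_injective
      apply SimpleGraph.Walk.support_injective
      change (((q.map φ.symm.toHom).copy _ _).map φ.toHom).support = q.support
      rw [SimpleGraph.Walk.support_map, SimpleGraph.Walk.support_copy,
        SimpleGraph.Walk.support_map, List.map_map]
      conv_rhs => rw [← List.map_id q.support]
      exact List.map_congr_left fun x _ => φ.apply_symm_apply x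
  have hlen : ∀ γ, (T γ).length = γ.length := fun γ => SimpleGraph.Walk.length_map _ _
  have hcurve : ∀ γ, (T γ).curve = CurveClass.map f γ.curve := by
    intro γ
    rw [SAW.DomainSAW.curve, SAW.DomainSAW.curve, CurveClass.map_mk]
    congr 1
    ext t
    exact toCurve_map_apply φ.toHom (meshPoint δ) (meshPoint δ') f hf hφ γ.walk t
  have hweight : (SAW.weight Ω δ a b).map T = SAW.weight Ω' δ' (φ a) (φ b) := by
    rw [SAW.weight, Measure.map_sum hTm.aemeasurable]
    simp only [Measure.map_smul, Measure.map_dirac' hTm]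
    rw [SAW.weight, ← Measure.sum_comp_equiv (Equiv.ofBijective T hTbij)]
    congr 1
    funext γ
    simp only [Function.comp_apply, Equiv.ofBijective_apply, hlen]
  have hlaw : (SAW.law Ω δ a b).map T = SAW.law Ω' δ' (φ a) (φ b) := by
    rw [SAW.law, Measure.map_smul, hweight, SAW.law, ← hweight,
      Measure.map_apply hTm MeasurableSet.univ, Set.preimage_univ]
  rw [Measure.map_map hfm (SAW.DomainSAW.measurable_of_top _), ← hlaw,
    Measure.map_map (SAW.DomainSAW.measurable_of_top _) hTm]
  congr 1
  funext γ
  exact (hcurve γ).symm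

/-! ### The quarter turn -/

/-- The rotation `z ↦ i z` written as the tree's similarity `similarity I _ 0` has the same images
as the plane action of the cell symmetry `CellSymmetry.rot`. [folklore] -/
theorem image_similarity_I (Ω : Set ℂ) :
    (similarity Complex.I Complex.I_ne_zero 0) '' Ω = CellSymmetry.rot.plane '' Ω :=
  Set.image_congr fun z _ => by simp

/-- **The quarter turn is an automorphism of the discretisation**: `rotCell = (x, y) ↦ (-y, x)`
carries the graph `Ω_δ` onto `(iΩ)_δ` (mesh vertices, the closed-segment edge rule and the
union-of-largest-components convention are all rotation-equivariant;
`CellSymmetry.discreteDomainGraph_adj_cell`). [folklore] -/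
theorem discreteDomainGraph_adj_rotCell {Ω : Set ℂ} {δ : ℝ} {x y : Site 2} :
    (discreteDomainGraph ((similarity Complex.I Complex.I_ne_zero 0) '' Ω) δ).Adj (rotCell x)
        (rotCell y) ↔ (discreteDomainGraph Ω δ).Adj x y := by
  rw [image_similarity_I]
  exact CellSymmetry.rot.discreteDomainGraph_adj_cell

/-- `z ↦ i z` realises the quarter turn on mesh points: `i (δ x) = δ (rotCell x)`. [folklore] -/
theorem similarity_I_meshPoint (δ : ℝ) (x : Site 2) :
    similarity Complex.I Complex.I_ne_zero 0 (meshPoint δ x) = meshPoint δ (rotCell x) := by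
  rw [similarity_apply, add_zero, SAW.Zd.I_mul_meshPoint]
  rfl

/-- `z ↦ i z` is affine on segments. [folklore] -/
theorem similarity_I_lineMap (x y : ℂ) (c : ℝ) :
    similarity Complex.I Complex.I_ne_zero 0 (AffineMap.lineMap x y c) =
      AffineMap.lineMap (similarity Complex.I Complex.I_ne_zero 0 x)
        (similarity Complex.I Complex.I_ne_zero 0 y) c := by
  simp only [similarity_apply, add_zero, AffineMap.lineMap_apply_module, mul_add, mul_smul_comm]

/-- Stub `stub_quarterTurnCovariance` (= item stmt-CriticalPhenomena-5794 verbatim). **Exact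
quarter-turn covariance of the critical `δℤ²` SAW law, at every mesh**: the critical SAW law in `Ω`
from `a` to `b`, pushed to curves and rotated by `z ↦ i z`, IS the critical SAW law in `iΩ` from the
rotated sites `(x, y) ↦ (-y, x)` pushed to curves (transport along the graph automorphism `rotCell`
of the discretisation, `map_curve_law_of_iso`); and an endpoint approximation of `D` rotates to one
of `D.map (z ↦ i z)` (reachability along the isomorphism; continuity of `z ↦ i z`). Beffara's
order-4 symmetry input, consumer-ready for the Assembly of the line. [folklore] -/
theorem stub_quarterTurnCovariance : SAWBrickWallHomotopy.QuarterTurnCovariance := by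
  refine ⟨fun Ω δ a b => ?_, fun D a b h => ?_⟩
  · exact map_curve_law_of_iso ⟨rotCell, discreteDomainGraph_adj_rotCell⟩ _
      (measurable_curveClassMap_similarity _ _ _) similarity_I_lineMap (similarity_I_meshPoint δ)
      rfl rfl
  · refine ⟨?_, ?_, ?_⟩
    · filter_upwards [h.reachable] with δ hδ
      exact hδ.map ⟨rotCell, discreteDomainGraph_adj_rotCell.2⟩
    · have key : (fun δ : ℝ => meshPoint δ ![-(a δ 1), a δ 0]) =
          similarity Complex.I Complex.I_ne_zero 0 ∘ fun δ => meshPoint δ (a δ) := by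
        funext δ
        exact (similarity_I_meshPoint δ (a δ)).symm
      rw [key]
      exact ((similarity Complex.I Complex.I_ne_zero 0).continuous.tendsto _).comp h.tendsto_fst
    · have key : (fun δ : ℝ => meshPoint δ ![-(b δ 1), b δ 0]) =
          similarity Complex.I Complex.I_ne_zero 0 ∘ fun δ => meshPoint δ (b δ) := by
        funext δ
        exact (similarity_I_meshPoint δ (b δ)).symm
      rw [key]
      exact ((similarity Complex.I Complex.I_ne_zero 0).continuous.tendsto _).comp h.tendsto_snd

end Summit.CriticalPhenomena.SAWScalingLimit.Cruxes.HexTransfer.PinTheShear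

end
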